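import Summits.CriticalPhenomena.PercolationContinuityZ3.Theorems.Transplant.SiteWorldDefs
import Summits.CriticalPhenomena.PercolationContinuityZ3.Theorems.Transplant.SiteCovTransferSet
import Summits.CriticalPhenomena.PercolationContinuityZ3.Theorems.PercNearOneGluingAdditiveGluingCSHHpart
import HarnessLib

/-!
# SITE percolation: LEMMA H of the site conditioned slack hierarchy — the H-part of the world-wise unfolding is nonnegative,
# given the site two-source diagonal (Htw)_site   (WP5 of P1-SITE-Z3 §12; site twin of `CSH.hpart_nonneg_of_htw`)

builds on p205010 (kernel theorem, internal audit signed; external expert review pending).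

Setting: vertex weights `q` with `0 < q u < 1`, owner `x ∈ S` (`S` = owner ∪ decoys), observers `o`, `v` (no `v ∉ S`, `v ∉ Y` needed in site form: the empty configuration witnesses positivity), worlds
`q^ω = SiteCSH.worldQ Γ q Y ω` (weight `0` on `Y`, on the clusters of `Y` and on their vertex boundary), integrated over `ω ∈ {x ↮ Y}`;
`g` monotone `≥ 0` on vertex sets; `p = P(o↔v | v ↮ S ∪ Y)` (`SiteCSH.obsConst`).
CLAIM (`siteHpart_nonneg_of_htw`): `0 ≤ ∫_{x↮Y} [Cov_{q^ω}(g(C_x),1{o↔S}) − p·Cov_{q^ω}(g(C_x),1{v↔S})] dμ_q`, GIVEN (Htw)_site (hypothesis `hHtw`,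
WP3–WP4 of the plan).  Proof verbatim from the bond file: (K6)_site world by world (`SiteCSH.siteCovTransfer_relaySet`, p211167, at the weights
`q^ω`, all `< 1` so `P_{q^ω}(v ↮ S) > 0`), then (Htw)_site trades the world constant for the global `p`.
Support file (`--supports stmt-CriticalPhenomena-4575 --as helper`); no definitions, no named facts, no sorries.
[cite: VandenbergHaggstromKahn2005, Thm. 1.4 (p. 7)] [cite: KozmaNitzan2024, Conj. 4 (p. 32)]
-/

noncomputable section

namespace Summit.CriticalPhenomena.PercolationContinuityZ3.Theorems.Transplant

namespace SiteCSH

open MeasureTheory Set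
open Literature.Probability.LatticeModels (prodBernoulli prodBernoulli_real_pos_of_nonempty)
open Literature.Probability.Percolation
open Summit.CriticalPhenomena.PercolationContinuityZ3.Theorems.CSH (prodBernoulli_real_pos_of_empty_mem)
open Summit.CriticalPhenomena.PercolationContinuityZ3.Theorems.SiteTransplant (siteConn mem_siteConn)
open scoped Classical

variable {n : ℕ} {Γ : SimpleGraph (Fin n)}

/-- **LEMMA H (site), given (Htw)_site.** [cite: VandenbergHaggstromKahn2005, Thm. 1.4 (p. 7)] -/
theorem siteHpart_nonneg_of_htw (q : Fin n → unitInterval) (hq : ∀ u, 0 < q u ∧ q u < 1) (x : Fin n) (Y : Set (Fin n))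
    (S : Finset (Fin n)) (hxS : x ∈ S) (o v : Fin n) (g : Set (Fin n) → ℝ)
    (hg : ∀ C C' : Set (Fin n), C ⊆ C' → g C ≤ g C') (hg0 : ∀ C, 0 ≤ g C)
    (hHtw : (prodBernoulli q).real ({ω : Set (Fin n) | ∀ a ∈ (↑S ∪ Y : Set (Fin n)), a ∉ siteCluster Γ ω v} ∩ siteConn Γ o v) *
        (∫ ω in {ω : Set (Fin n) | ∀ y ∈ Y, y ∉ siteCluster Γ ω x},
          ((∫ η in (⋃ t ∈ S, siteConn Γ v t), g (siteCluster Γ η x) ∂(prodBernoulli (worldQ Γ q Y ω))) -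
            (prodBernoulli (worldQ Γ q Y ω)).real (⋃ t ∈ S, siteConn Γ v t) *
              (∫ η, g (siteCluster Γ η x) ∂(prodBernoulli (worldQ Γ q Y ω))))
          ∂(prodBernoulli q)) ≤
      (prodBernoulli q).real {ω : Set (Fin n) | ∀ a ∈ (↑S ∪ Y : Set (Fin n)), a ∉ siteCluster Γ ω v} *
        (∫ ω in {ω : Set (Fin n) | ∀ y ∈ Y, y ∉ siteCluster Γ ω x},
          ((prodBernoulli (worldQ Γ q Y ω)).real
                ({η : Set (Fin n) | ∀ t ∈ S, t ∉ siteCluster Γ η v} ∩ siteConn Γ o v) /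
              (prodBernoulli (worldQ Γ q Y ω)).real {η : Set (Fin n) | ∀ t ∈ S, t ∉ siteCluster Γ η v}) *
          ((∫ η in (⋃ t ∈ S, siteConn Γ v t), g (siteCluster Γ η x) ∂(prodBernoulli (worldQ Γ q Y ω))) -
            (prodBernoulli (worldQ Γ q Y ω)).real (⋃ t ∈ S, siteConn Γ v t) *
              (∫ η, g (siteCluster Γ η x) ∂(prodBernoulli (worldQ Γ q Y ω))))
          ∂(prodBernoulli q))) :
    0 ≤ ∫ ω in {ω : Set (Fin n) | ∀ y ∈ Y, y ∉ siteCluster Γ ω x},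
      (((∫ η in (⋃ t ∈ S, siteConn Γ o t), g (siteCluster Γ η x) ∂(prodBernoulli (worldQ Γ q Y ω))) -
          (prodBernoulli (worldQ Γ q Y ω)).real (⋃ t ∈ S, siteConn Γ o t) *
            (∫ η, g (siteCluster Γ η x) ∂(prodBernoulli (worldQ Γ q Y ω)))) -
        obsConst Γ q o v (↑S ∪ Y) *
          ((∫ η in (⋃ t ∈ S, siteConn Γ v t), g (siteCluster Γ η x) ∂(prodBernoulli (worldQ Γ q Y ω))) -
            (prodBernoulli (worldQ Γ q Y ω)).real (⋃ t ∈ S, siteConn Γ v t) *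
              (∫ η, g (siteCluster Γ η x) ∂(prodBernoulli (worldQ Γ q Y ω)))))
      ∂(prodBernoulli q) := by
  set μ := prodBernoulli q with hμ
  set qW : Set (Fin n) → Fin n → unitInterval := fun ω => worldQ Γ q Y ω with hqW
  set CovO : Set (Fin n) → ℝ := fun ω =>
    (∫ η in (⋃ t ∈ S, siteConn Γ o t), g (siteCluster Γ η x) ∂(prodBernoulli (qW ω))) -
      (prodBernoulli (qW ω)).real (⋃ t ∈ S, siteConn Γ o t) * ∫ η, g (siteCluster Γ η x) ∂(prodBernoulli (qW ω)) with hCovO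
  set CovV : Set (Fin n) → ℝ := fun ω =>
    (∫ η in (⋃ t ∈ S, siteConn Γ v t), g (siteCluster Γ η x) ∂(prodBernoulli (qW ω))) -
      (prodBernoulli (qW ω)).real (⋃ t ∈ S, siteConn Γ v t) * ∫ η, g (siteCluster Γ η x) ∂(prodBernoulli (qW ω)) with hCovV
  set pW : Set (Fin n) → ℝ := fun ω =>
    (prodBernoulli (qW ω)).real ({η : Set (Fin n) | ∀ t ∈ S, t ∉ siteCluster Γ η v} ∩ siteConn Γ o v) /
      (prodBernoulli (qW ω)).real {η : Set (Fin n) | ∀ t ∈ S, t ∉ siteCluster Γ η v} with hpW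
  set M : ℝ := μ.real {ω : Set (Fin n) | ∀ a ∈ (↑S ∪ Y : Set (Fin n)), a ∉ siteCluster Γ ω v} with hM
  set E : ℝ := μ.real ({ω : Set (Fin n) | ∀ a ∈ (↑S ∪ Y : Set (Fin n)), a ∉ siteCluster Γ ω v} ∩ siteConn Γ o v) with hE
  set Dset : Set (Set (Fin n)) := {ω : Set (Fin n) | ∀ y ∈ Y, y ∉ siteCluster Γ ω x} with hDset
  change E * ∫ ω in Dset, CovV ω ∂μ ≤ M * ∫ ω in Dset, pW ω * CovV ω ∂μ at hHtw
  change 0 ≤ ∫ ω in Dset, (CovO ω - obsConst Γ q o v (↑S ∪ Y) * CovV ω) ∂μ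
  have hmeas : ∀ T : Set (Set (Fin n)), MeasurableSet T := fun _ => MeasurableSet.of_discrete
  have hint : ∀ (k : Set (Fin n) → ℝ) (T : Set (Set (Fin n))), IntegrableOn k T μ :=
    fun k T => (Integrable.of_finite).integrableOn
  -- positivity of the global conditioning probability and the observers' constant (the empty configuration avoids everything)
  have hMpos : 0 < M := prodBernoulli_real_pos_of_nonempty hq ⟨∅, fun a _ h => h.1⟩
  have hobs : obsConst Γ q o v (↑S ∪ Y) = E / M := by unfold obsConst; rfl
  -- (K6)_site in each world: `pW ω · CovV ω ≤ CovO ω`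
  have hworld : ∀ ω : Set (Fin n), pW ω * CovV ω ≤ CovO ω := by
    intro ω
    have hK6 := siteCovTransfer_relaySet (Γ := Γ) (qW ω) S o v x hxS g hg hg0
    have hlt : ∀ u, qW ω u < 1 := fun u => worldQ_lt_one (fun u => (hq u).2) Y ω u
    have hMWpos : 0 < (prodBernoulli (qW ω)).real {η : Set (Fin n) | ∀ t ∈ S, t ∉ siteCluster Γ η v} :=
      prodBernoulli_real_pos_of_empty_mem (qW ω) hlt (fun t _ h => h.1)
    set MW := (prodBernoulli (qW ω)).real {η : Set (Fin n) | ∀ t ∈ S, t ∉ siteCluster Γ η v} with hMW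
    set EW := (prodBernoulli (qW ω)).real ({η : Set (Fin n) | ∀ t ∈ S, t ∉ siteCluster Γ η v} ∩ siteConn Γ o v) with hEW
    change EW * CovV ω ≤ MW * CovO ω at hK6
    have hp : pW ω = EW / MW := rfl
    rw [hp, div_mul_eq_mul_div, div_le_iff₀ hMWpos]
    linarith [hK6, mul_comm MW (CovO ω)]
  -- integrate the world inequality over `Dset`
  have hI1 : ∫ ω in Dset, pW ω * CovV ω ∂μ ≤ ∫ ω in Dset, CovO ω ∂μ :=
    setIntegral_mono_on (hint _ _) (hint _ _) (hmeas Dset) fun ω _ => hworld ω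
  -- (Htw)_site divided by `M`
  have hI2 : E / M * ∫ ω in Dset, CovV ω ∂μ ≤ ∫ ω in Dset, pW ω * CovV ω ∂μ := by
    rw [div_mul_eq_mul_div, div_le_iff₀ hMpos]
    linarith [hHtw, mul_comm M (∫ ω in Dset, pW ω * CovV ω ∂μ)]
  rw [integral_sub (hint _ _) (hint _ _), integral_const_mul, hobs]
  linarith [hI1, hI2]

end SiteCSH

end Summit.CriticalPhenomena.PercolationContinuityZ3.Theorems.Transplant
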